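import Summits.Ventures.CertifiedManyBodySolver.Downfold.EmeryAxialWeightProfile
import Summits.Ventures.CertifiedManyBodySolver.Downfold.EmerySecularFormDefectCheck
import HarnessLib

/-!
# The near-nodal enhancement, kernel-decidable: `vsqCheck` — a certified lower value of the geometric factor `G` of a typed σ row over
# its Fermi-energy bracket, and the composed bound `E(a′) ≥ (1 + δlo + a′κlo)·Glo` with `fdCheck`

Venture CertifiedManyBodySolver, cell `pub/hubbard-downfold` (stage S1; INFLATION-RULES-3to1-B §B.80 (h)), seat hubbard-downfold-mod-4 (technique B, g32);
namespace `Summit.Ventures.CertifiedManyBodySolver.Downfold.Emery`. Companion of `EmeryAxialWeightProfile` (`geomFactor`, `nodalEnhancement`: the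
`(cos k_x − cos k_y)²` interlayer form factor scaled to the antinode under-weights the near-nodal Cu-4s weight by `E = (W4(an)/W4(node))·G`) and of
`EmerySecularFormDefectCheck` (`fdCheck`: `W4(an)/W4(node) − 1 ∈ [δlo + a′κlo, δhi + a′κhi]`). Everything PROVED. WHAT THIS IS NOT: a statement about any
material; no number lives here; U = 0 band kinematics.

* §1 interval images `ifsRatioDN = fsD/fsN`, `igeomNum = 1 + y_a + 2x_node + fsD/fsN`, `igeomDen = 4x_node + fsD/fsN`, `igeom = igeomNum/igeomDen` on the
  tree's ℚ-interval toolkit (`EmeryFermiVelocityScaleIntervals`: `ihull`, `mooreMul`, `idivPos`, `iscale`; `isNode`, `iyFace`, `iFaceDen`, `ifsD1`, `ifsN1` of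
  `EmerySecularFormDefectCheck`), inclusion-sound by construction.
* §2 `vsqCheck Δ a b c e₁ e₂ glo` — a plain conjunction of rational tests decided by `decide +kernel`; SOUNDNESS `geomFactor_ge_of_vsqCheck`: for every
  `ε ∈ [e₁, e₂]`, `glo ≤ geomFactor Δ a b c (yFace ε) ε` and `0 ≤ x_node(ε)`; COMPOSITION `nodalEnhancement_ge_of_checks`: with `fdCheck` on the same point and
  bracket, for every admixture slope `a′ ≥ 0`, `(1 + δlo + a′·κlo)·glo ≤ nodalEnhancement Δ a b c a′ (yFace ε) ε` (when `1 + δlo ≥ 0`, `κlo ≥ 0`, `glo ≥ 0`).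

Census files: `EmeryVsqProfileRows*` (one `vsqCheck … = true` per typed σ row of router/EMERY-FORM-DEFECT.tsv; router/VSQ-PROFILE.tsv v1.1 column `G_lo_KERNEL`).
Sources: [AndersenEtAl1995, Eq. (24)]; interval arithmetic [folklore] (Moore 1966).
-/

noncomputable section

namespace Summit.Ventures.CertifiedManyBodySolver.Downfold.Emery

open Real Set NonemptyInterval

/-! ## §1 Interval images -/

/-- Image of `fsD/fsN`. [folklore] -/
def ifsRatioDN (IΔ Ia Ib Ic Ie : NonemptyInterval ℚ) : NonemptyInterval ℚ := idivPos (ifsD IΔ Ia Ic Ie) (ifsN Ia Ib Ic Ie)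

/-- Image of the numerator `1 + y_a + 2x_node + fsD/fsN` of `geomFactor`. [folklore] -/
def igeomNum (IΔ Ia Ib Ic Ie : NonemptyInterval ℚ) : NonemptyInterval ℚ :=
  NonemptyInterval.pure 1 + iyFace IΔ Ia Ib Ic Ie + isNode IΔ Ia Ib Ic Ie + ifsRatioDN IΔ Ia Ib Ic Ie

/-- Image of the denominator `4x_node + fsD/fsN = 2·(2x_node) + fsD/fsN` of `geomFactor`. [folklore] -/
def igeomDen (IΔ Ia Ib Ic Ie : NonemptyInterval ℚ) : NonemptyInterval ℚ :=
  iscale 2 (isNode IΔ Ia Ib Ic Ie) + ifsRatioDN IΔ Ia Ib Ic Ie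

/-- Image of `geomFactor`. [folklore] -/
def igeom (IΔ Ia Ib Ic Ie : NonemptyInterval ℚ) : NonemptyInterval ℚ := idivPos (igeomNum IΔ Ia Ib Ic Ie) (igeomDen IΔ Ia Ib Ic Ie)

/-! ## §2 The checker, its soundness, and the composition with `fdCheck` -/

/-- **`vsqCheck`** — the kernel-decidable point rule for the geometric factor: regime tests (`fsN, fsD1, fsN1 > 0`, face and node denominators `> 0` on
the images) and the claim `glo ≤ inf G` over the energy piece `[e₁, e₂]`. [folklore] -/
def vsqCheck (Δ a b c e₁ e₂ glo : ℚ) : Bool :=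
  let IΔ := ihull Δ Δ
  let Ia := ihull a a
  let Ib := ihull b b
  let Ic := ihull c c
  let Ie := ihull e₁ e₂
  decide (0 < (ifsN Ia Ib Ic Ie).fst) && decide (0 < (ifsD1 IΔ Ie).fst) && decide (0 < (ifsN1 Ia Ib Ic Ie).fst) &&
  decide (0 < (iFaceDen IΔ Ia Ib Ic Ie).fst) && decide (0 < (igeomDen IΔ Ia Ib Ic Ie).fst) &&
  decide (glo ≤ (igeom IΔ Ia Ib Ic Ie).fst)

/-- **SOUNDNESS of `vsqCheck`**: for every `ε` in the piece, `glo ≤ geomFactor Δ a b c (yFace ε) ε` and `0 ≤ x_node(ε)`. [folklore] -/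
theorem geomFactor_ge_of_vsqCheck {Δ a b c e₁ e₂ glo : ℚ} (h : vsqCheck Δ a b c e₁ e₂ glo = true)
    {ε : ℝ} (he : ε ∈ Set.Icc (e₁ : ℝ) e₂) :
    (glo : ℝ) ≤ geomFactor (Δ : ℝ) a b c (yFace (Δ : ℝ) a b c ε) ε ∧ 0 ≤ xNode (Δ : ℝ) a b c ε := by
  simp only [vsqCheck, Bool.and_eq_true, decide_eq_true_eq] at h
  obtain ⟨⟨⟨⟨⟨hNq, hD1q⟩, hN1q⟩, hFq⟩, hGq⟩, hglo⟩ := h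
  obtain ⟨mcA, mD, mN, -, -, -, -⟩ :=
    mem_images (mem_Icc_self_cast Δ) (mem_Icc_self_cast a) (mem_Icc_self_cast b) (mem_Icc_self_cast c) he
  have mΔ := mem_ihull (mem_Icc_self_cast Δ)
  have ma := mem_ihull (mem_Icc_self_cast a)
  have mb := mem_ihull (mem_Icc_self_cast b)
  have mc := mem_ihull (mem_Icc_self_cast c)
  have me := mem_ihull he
  have m1 : (1 : ℝ) ∈ (NonemptyInterval.pure (1 : ℚ)).ratCast ℝ := mem_pure_of_cast_eq (by norm_num)
  have m2 : (2 : ℝ) ∈ (NonemptyInterval.pure (2 : ℚ)).ratCast ℝ := mem_pure_of_cast_eq (by norm_num)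
  have m4 : (4 : ℝ) ∈ (NonemptyInterval.pure (4 : ℚ)).ratCast ℝ := mem_pure_of_cast_eq (by norm_num)
  have mD1 : fsD1 (Δ : ℝ) ε ∈ (ifsD1 (ihull Δ Δ) (ihull e₁ e₂)).ratCast ℝ := by
    unfold fsD1 ifsD1; exact mem_ratCast_mul me (mem_ratCast_add mΔ me)
  have mN1 : fsN1 (a : ℝ) b c ε ∈ (ifsN1 (ihull a a) (ihull b b) (ihull c c) (ihull e₁ e₂)).ratCast ℝ := by
    unfold fsN1 ifsN1
    exact mem_ratCast_add (mem_ratCast_mul m4 (mem_ratCast_sq ma)) (mem_ratCast_mul (mem_ratCast_mul m2 me) (mem_ratCast_sub mb mc))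
  have hN : 0 < fsN (a : ℝ) b c ε := lt_of_lt_of_le (by exact_mod_cast hNq) (mem_ratCast_iff.mp mN).1
  have hD1 : 0 < fsD1 (Δ : ℝ) ε := lt_of_lt_of_le (by exact_mod_cast hD1q) (mem_ratCast_iff.mp mD1).1
  have hN1 : 0 < fsN1 (a : ℝ) b c ε := lt_of_lt_of_le (by exact_mod_cast hN1q) (mem_ratCast_iff.mp mN1).1
  -- u_node = 2 x_node = fsD1/fsN1
  have hun : 2 * xNode (Δ : ℝ) a b c ε = fsD1 (Δ : ℝ) ε / fsN1 (a : ℝ) b c ε := by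
    unfold xNode; field_simp
  have mun : 2 * xNode (Δ : ℝ) a b c ε ∈ (isNode (ihull Δ Δ) (ihull a a) (ihull b b) (ihull c c) (ihull e₁ e₂)).ratCast ℝ := by
    rw [hun]; unfold isNode; exact mem_idivPos hN1q mD1 mN1
  have hxn : 0 ≤ xNode (Δ : ℝ) a b c ε := by
    unfold xNode; exact div_nonneg hD1.le (by linarith)
  -- y_a
  have m4D : (4 : ℝ) * fsD (Δ : ℝ) a c ε ∈ (iscale 4 (ifsD (ihull Δ Δ) (ihull a a) (ihull c c) (ihull e₁ e₂))).ratCast ℝ := by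
    have := mem_iscale 4 mD; push_cast at this; exact this
  have m16N : (16 : ℝ) * fsN (a : ℝ) b c ε ∈ (iscale 16 (ifsN (ihull a a) (ihull b b) (ihull c c) (ihull e₁ e₂))).ratCast ℝ := by
    have := mem_iscale 16 mN; push_cast at this; exact this
  have mFden : 4 * fsD (Δ : ℝ) a c ε + 16 * fsN (a : ℝ) b c ε ∈
      (iFaceDen (ihull Δ Δ) (ihull a a) (ihull b b) (ihull c c) (ihull e₁ e₂)).ratCast ℝ := by
    unfold iFaceDen; exact mem_ratCast_add m4D m16N
  have mya : yFace (Δ : ℝ) a b c ε ∈ (iyFace (ihull Δ Δ) (ihull a a) (ihull b b) (ihull c c) (ihull e₁ e₂)).ratCast ℝ := by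
    unfold yFace iyFace; exact mem_idivPos hFq (mem_ratCast_sub mcA m4D) mFden
  -- r = fsD/fsN
  have mr : fsD (Δ : ℝ) a c ε / fsN (a : ℝ) b c ε ∈ (ifsRatioDN (ihull Δ Δ) (ihull a a) (ihull b b) (ihull c c) (ihull e₁ e₂)).ratCast ℝ := by
    unfold ifsRatioDN; exact mem_idivPos hNq mD mN
  -- numerator and denominator of G
  have mnum : 1 + yFace (Δ : ℝ) a b c ε + 2 * xNode (Δ : ℝ) a b c ε + fsD (Δ : ℝ) a c ε / fsN (a : ℝ) b c ε ∈
      (igeomNum (ihull Δ Δ) (ihull a a) (ihull b b) (ihull c c) (ihull e₁ e₂)).ratCast ℝ := by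
    unfold igeomNum; exact mem_ratCast_add (mem_ratCast_add (mem_ratCast_add m1 mya) mun) mr
  have m2un : (2 : ℝ) * (2 * xNode (Δ : ℝ) a b c ε) ∈ (iscale 2 (isNode (ihull Δ Δ) (ihull a a) (ihull b b) (ihull c c) (ihull e₁ e₂))).ratCast ℝ := by
    have := mem_iscale 2 mun; push_cast at this; exact this
  have mden : 4 * xNode (Δ : ℝ) a b c ε + fsD (Δ : ℝ) a c ε / fsN (a : ℝ) b c ε ∈
      (igeomDen (ihull Δ Δ) (ihull a a) (ihull b b) (ihull c c) (ihull e₁ e₂)).ratCast ℝ := by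
    have e : (4 : ℝ) * xNode (Δ : ℝ) a b c ε = 2 * (2 * xNode (Δ : ℝ) a b c ε) := by ring
    rw [e]; unfold igeomDen; exact mem_ratCast_add m2un mr
  have mG : geomFactor (Δ : ℝ) a b c (yFace (Δ : ℝ) a b c ε) ε ∈ (igeom (ihull Δ Δ) (ihull a a) (ihull b b) (ihull c c) (ihull e₁ e₂)).ratCast ℝ := by
    unfold geomFactor igeom; exact mem_idivPos hGq mnum mden
  exact ⟨le_trans (by exact_mod_cast hglo) (mem_ratCast_iff.mp mG).1, hxn⟩

/-- **COMPOSITION**: `fdCheck` and `vsqCheck` on the same rational σ point and energy piece give, for every `ε` in the piece and every admixture slope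
`a′ ≥ 0`, `(1 + δlo + a′·κlo)·glo ≤ E(a′) = nodalEnhancement Δ a b c a′ (yFace ε) ε` (with `1 + δlo ≥ 0`, `κlo ≥ 0`, `glo ≥ 0`): the certified near-nodal
under-weighting of the `v²` form factor. [folklore] -/
theorem nodalEnhancement_ge_of_checks {Δ a b c e₁ e₂ dlo dhi klo khi glo : ℚ}
    (hfd : fdCheck Δ a b c e₁ e₂ dlo dhi klo khi = true) (hv : vsqCheck Δ a b c e₁ e₂ glo = true)
    (hd : 0 ≤ 1 + dlo) (hk : 0 ≤ klo) (hg : 0 ≤ glo)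
    {ε a' : ℝ} (he : ε ∈ Set.Icc (e₁ : ℝ) e₂) (ha' : 0 ≤ a') :
    ((1 + dlo + a' * klo) * glo : ℝ) ≤ nodalEnhancement (Δ : ℝ) a b c a' (yFace (Δ : ℝ) a b c ε) ε := by
  obtain ⟨hG, hxn⟩ := geomFactor_ge_of_vsqCheck hv he
  -- regime facts from `vsqCheck` for the two contour points
  have hv' := hv
  simp only [vsqCheck, Bool.and_eq_true, decide_eq_true_eq] at hv'
  obtain ⟨⟨⟨⟨⟨hNq, hD1q⟩, hN1q⟩, hFq⟩, -⟩, -⟩ := hv'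
  obtain ⟨mcA, mD, mN, -, -, -, -⟩ :=
    mem_images (mem_Icc_self_cast Δ) (mem_Icc_self_cast a) (mem_Icc_self_cast b) (mem_Icc_self_cast c) he
  have mΔ := mem_ihull (mem_Icc_self_cast Δ)
  have ma := mem_ihull (mem_Icc_self_cast a)
  have mb := mem_ihull (mem_Icc_self_cast b)
  have mc := mem_ihull (mem_Icc_self_cast c)
  have me := mem_ihull he
  have m2 : (2 : ℝ) ∈ (NonemptyInterval.pure (2 : ℚ)).ratCast ℝ := mem_pure_of_cast_eq (by norm_num)
  have m4 : (4 : ℝ) ∈ (NonemptyInterval.pure (4 : ℚ)).ratCast ℝ := mem_pure_of_cast_eq (by norm_num)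
  have mN1 : fsN1 (a : ℝ) b c ε ∈ (ifsN1 (ihull a a) (ihull b b) (ihull c c) (ihull e₁ e₂)).ratCast ℝ := by
    unfold fsN1 ifsN1
    exact mem_ratCast_add (mem_ratCast_mul m4 (mem_ratCast_sq ma)) (mem_ratCast_mul (mem_ratCast_mul m2 me) (mem_ratCast_sub mb mc))
  have hN1 : 0 < fsN1 (a : ℝ) b c ε := lt_of_lt_of_le (by exact_mod_cast hN1q) (mem_ratCast_iff.mp mN1).1
  have m4D : (4 : ℝ) * fsD (Δ : ℝ) a c ε ∈ (iscale 4 (ifsD (ihull Δ Δ) (ihull a a) (ihull c c) (ihull e₁ e₂))).ratCast ℝ := by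
    have := mem_iscale 4 mD; push_cast at this; exact this
  have m16N : (16 : ℝ) * fsN (a : ℝ) b c ε ∈ (iscale 16 (ifsN (ihull a a) (ihull b b) (ihull c c) (ihull e₁ e₂))).ratCast ℝ := by
    have := mem_iscale 16 mN; push_cast at this; exact this
  have mFden : 4 * fsD (Δ : ℝ) a c ε + 16 * fsN (a : ℝ) b c ε ∈
      (iFaceDen (ihull Δ Δ) (ihull a a) (ihull b b) (ihull c c) (ihull e₁ e₂)).ratCast ℝ := by
    unfold iFaceDen; exact mem_ratCast_add m4D m16N
  have hFden : 0 < 4 * fsD (Δ : ℝ) a c ε + 16 * fsN (a : ℝ) b c ε := lt_of_lt_of_le (by exact_mod_cast hFq) (mem_ratCast_iff.mp mFden).1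
  have hPn : charCubic (Δ : ℝ) a b c (xNode (Δ : ℝ) a b c ε) (xNode (Δ : ℝ) a b c ε) ε = 0 := charCubic_xNode hN1.ne'
  have hPa : charCubic (Δ : ℝ) a b c 1 (yFace (Δ : ℝ) a b c ε) ε = 0 := charCubic_yFace hFden.ne'
  have h4 := formDefect4_of_fdCheck hfd he hxn ha' hPn hPa
  have h1 : (1 : ℝ) + dlo + a' * klo ≤
      W4 (Δ : ℝ) a b c a' 1 (yFace (Δ : ℝ) a b c ε) ε / W4 (Δ : ℝ) a b c a' (xNode (Δ : ℝ) a b c ε) (xNode (Δ : ℝ) a b c ε) ε := by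
    linarith [h4.1]
  have hpos : (0 : ℝ) ≤ 1 + dlo + a' * klo := by
    have : (0 : ℝ) ≤ a' * klo := mul_nonneg ha' (by exact_mod_cast hk)
    have hd' : (0 : ℝ) ≤ 1 + dlo := by exact_mod_cast hd
    linarith
  unfold nodalEnhancement
  exact mul_le_mul h1 hG (by exact_mod_cast hg) (le_trans hpos h1)

end Summit.Ventures.CertifiedManyBodySolver.Downfold.Emery
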